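/-
Copyright: the b2b-balaban cell (near-miss cell 7), T⁴-continuum fan-out; row NE7b ROUND-2 swarm, seat
t4-ne7b-formalise-leaf-02 gen 4 (row S6g′ instance sub-piece «INST-SUP» of `t4/b2b-balaban-t4-ne7b-p1/LEAVES-NE7b.md`:
the END composed with parts 1–3).
Released under the licence of the surrounding project.
-/
import Summits.QuantumFields.BalabanUV.T4Continuum.Support.HistoryJoinsEnd
import Summits.QuantumFields.BalabanUV.T4Continuum.Support.HistoryJoinsSupTorus
import Summits.QuantumFields.BalabanUV.T4Continuum.Support.HistoryJoinsSupExtent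

/-!
# History joins, suprema — part 4: THE END WITH THE LOCAL LAWS DISCHARGED (row S6g′, instance sub-piece INST-SUP)

Summits-side support leaf of the T⁴-continuum cell (rung (B)+1 on a FINITE torus only; NOT infinite volume, NOT the
mass gap, NOT the Clay statement; NOT a proof of the spine estimate NE7b).  Row NE7b, route «COUNT»; row S6g′.
[folklore] composition of leaf-05 gen 2's END `HistoryJoinsEnd.card_S_le_exp_pow` with parts 1–3
(`HistoryJoinsSup`, `HistoryJoinsSupTorus`, `HistoryJoinsSupExtent`); real arithmetic and finite bookkeeping over the
swarm's own carriers; nothing is quoted from print, nothing printed is asserted, no `[cite:]` tag, no `Prop` fact.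

WHAT.
* §1 **`card_S_le_exp_pow_sup`** — the END for ANY zone map, with `M := Msup`, `ext := extsup … δ`: the local laws
  `hcard`∕`hloc` are GONE; what is displayed is the reading fact `hnearW`, the one-block count `hNZ`∕`hNZle` with the
  exponential type of `Mρ`, the two PER-PLACEMENT laws AT THE JOINS (cardinality `hlawM`, extent `hlawE`) in `zmass`
  currency, `Dated`∕`Chrono`, the signs, and the sibling-entropy input `hENT`:
  `#S G z ≤ exp((2 + κM + κρ + κE)·F)·(Λ·e^{μE})^{partnerAges}`, `F = Σ_births (fat+1)`,
  `κM = (WB + WM)∕(1 − θ) + 2γ′`, `κρ = 2(a + d′·c₁) + d′·C₁·(WB + WM)∕(1 − θ)`.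
* §2 **`card_S_le_exp_pow_torus`** — the same ON THE TORUS AT LEVELS (cells `TCell d (n·L^K)`, blocks `Fin d → ℕ`,
  nearness `nearD n L K lv`, witness radius `radT` = cyclic sup-distance to the root cell's block, `NZ := NZD d L lv`,
  `Mρ := MρT d`, `Λ := L^d`, `a := 0`, `d′ := 2d`): displayed are ONLY the guarded-reading fact `hzoneW` («a nonempty
  zone sits at a level `lv t ≤ K`, in range, under a scale-`lv (rootStep)` root cell»), the four per-placement reading
  facts at the joins `hfacts` («a nonempty zone of a part at a join is in range, `ρℓ`-linked, contains the root cell's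
  block, and obeys the cardinality law `#zone ≤ zmass + γ′`»), `Dated`∕`Chrono`, `hENT`, `LevelFn K lv`, `1 ≤ L` and
  the signs; `κM = (WB + WM)∕(1 − θ) + 2γ′`, `κρ = 8d·ρℓ·γ′ + 2d·ρℓ·(WB + WM)∕(1 − θ)`.

DESIGN NOTE for the instance seat.  The END's local laws quantify over EVERY canonically admissible junk placement,
not only realised ones; `hzoneW`∕`hfacts` are asked of NONEMPTY zones only, so the instance's zone map should be
GUARDED — `zone t Z p := the region reading's zone if lv t ≤ K ∧ IsScale L (lv Z.rootStep) (root cell of p), else ∅` —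
realised placements (scale root cells, steps `≤ K`) see the true zones, the others cost nothing.

HONEST SCOPE.  Composition only; the displayed facts have named suppliers (rows (a)∕S6∕S6g′(f), `HistoryJoinsTag`);
«realised placements are canonically admissible» is the H3 reading side; `BirthShapeNodup` is NOT retired by this
file; NE7b NOT proved; spine 0∕9.  HONEST DEPENDENCY (cell): continuum YM on T⁴ ⇐ BetaPertH ∧ nine spine estimates
(0/9 proved); BetaPertH ⇐ (D1) ∧ (D4) ∧ CAP+tail; G-an2-4 gates asym, D1 and NE2/3/4.  This file changes none of it.
-/

open Finset
open Literature.MathematicalPhysics.QuantumFieldTheory.Balaban1983to89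
open T4PersistenceDictionary T4PartnerMultiplicity T4BranchingRecordsGas
open Summit.QuantumFields.BalabanUV.T4Continuum.HistoryJoins
open Summit.QuantumFields.BalabanUV.T4Continuum.HistoryJoinsAdm
open Summit.QuantumFields.BalabanUV.T4Continuum.HistoryJoinsBudget
open Summit.QuantumFields.BalabanUV.T4Continuum.HistoryJoinsEntropyBudget
open Summit.QuantumFields.BalabanUV.T4Continuum.HistoryJoinsEnd
open Summit.QuantumFields.BalabanUV.T4Continuum.HistoryJoinsSup
open Summit.QuantumFields.BalabanUV.T4Continuum.HistoryJoinsSupTorus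
open Summit.QuantumFields.BalabanUV.T4Continuum.HistoryJoinsSupExtent
open Summit.QuantumFields.BalabanUV.T4Continuum.ZoneTorus
open Summit.QuantumFields.BalabanUV.T4Continuum.ZoneSkeleton
open Summit.QuantumFields.BalabanUV.T4Continuum.HistoryZones
open Summit.QuantumFields.BalabanUV.T4Continuum.HistoryZoneMass
open Summit.QuantumFields.BalabanUV.T4Continuum.HistoryMassPlacement
open Summit.QuantumFields.BalabanUV.T4Continuum.HistoryZoneMassJoins
open Summit.QuantumFields.BalabanUV.T4Continuum.HistoryZoneMassLaw

namespace Summit.QuantumFields.BalabanUV.T4Continuum.HistoryJoinsSupEnd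

noncomputable section

open scoped Classical

/-! ## §1 The END for any zone map, local laws discharged by suprema -/

section Generic

variable {ε γ β R : Type*} [DecidableEq β] [LinearOrder R] [Fintype γ] {D : ℕ} [DecidableEq ε] (sh : ε → PEv)
  (zone : ℕ → Gen ε → (Addr D → γ) → Finset β) (ρ : (Addr D → γ) → R) (c₀ : γ)
  (δ : β → ℕ → γ → ℕ → ℝ) (near : β → ℕ → γ → ℕ → ℝ → Prop)

/-- **ROW S6g′, THE END WITH `hcard`∕`hloc` DISCHARGED** (`M := Msup`, `ext := extsup`): for every shape tree `G` read
by `st := PEv.step ∘ sh`, under the reading fact `hnearW`, the one-block count with its fibre shape and exponential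
type, the per-placement cardinality and extent laws AT THE JOINS in `zmass` currency, `Dated`∕`Chrono`, the signs and the
sibling-entropy input:
`#S G z ≤ exp((2 + κM + κρ + κE)·F)·(Λ·e^{μE})^{partnerAges}` with `κM = (WB+WM)∕(1−θ) + 2γ′`,
`κρ = 2(a + d′c₁) + d′C₁(WB+WM)∕(1−θ)`. [folklore] -/
theorem card_S_le_exp_pow_sup
    (hmono : ∀ u t y s (r r' : ℝ), near u t y s r → r ≤ r' → near u t y s r')
    (hnearW : ∀ (t : ℕ) (Z : Gen ε) (p : Addr D → γ) (u : β), p ∈ Sany zone ρ c₀ (PEv.step ∘ sh) Z →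
      u ∈ zone t Z p → near u t (evalA c₀ p (rootAddr Z)) Z.rootStep (δ u t (evalA c₀ p (rootAddr Z)) Z.rootStep))
    (NZ : ℝ → ℕ → ℕ → ℕ)
    (hNZ : ∀ (u : β) (t s : ℕ) (r : ℝ), (univ.filter fun y : γ => near u t y s r).card ≤ NZ r t s)
    {Λ : ℝ} (hΛ : 0 ≤ Λ) (Mρ : ℝ → ℝ) (hMρ0 : ∀ r, 0 ≤ Mρ r)
    (hNZle : ∀ (r : ℝ) (t s : ℕ), (NZ r t s : ℝ) ≤ Mρ r * Λ ^ (t + 1 - s))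
    {a d' : ℝ} (ha : 0 ≤ a) (hd : 0 ≤ d') (hMρ : ∀ r, 0 ≤ r → Mρ r ≤ Real.exp (a + d' * r))
    {θ WB WM γ' C₁ c₁ : ℝ} (hθ0 : 0 ≤ θ) (hθ1 : θ < 1) (hB : 0 ≤ WB) (hM : 0 ≤ WM) (hγ : 0 ≤ γ')
    (hC₁ : 0 ≤ C₁) (hc₁ : 0 ≤ c₁)
    {G : Gen ε} {T : ℕ} (hD : Dated (PEv.step ∘ sh) true T G) (hC : Chrono (PEv.step ∘ sh) G)
    (hlawM : ∀ X ∈ joins (PEv.step ∘ sh) G, ∀ P ∈ tparts (PEv.step ∘ sh) X,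
      ∀ p ∈ Sany zone ρ c₀ (PEv.step ∘ sh) P,
        ((zone (ftime (PEv.step ∘ sh) X) P p).card : ℝ) ≤ zmass sh θ WB WM (ftime (PEv.step ∘ sh) X) P + γ')
    (hlawE : ∀ X ∈ joins (PEv.step ∘ sh) G, ∀ P ∈ tparts (PEv.step ∘ sh) X,
      ∀ p ∈ Sany zone ρ c₀ (PEv.step ∘ sh) P, ∀ u ∈ zone (ftime (PEv.step ∘ sh) X) P p,
        δ u (ftime (PEv.step ∘ sh) X) (evalA c₀ p (rootAddr P)) P.rootStep ≤
          C₁ * zmass sh θ WB WM (ftime (PEv.step ∘ sh) X) P + c₁)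
    {κE μE : ℝ}
    (hENT : ENT (PEv.step ∘ sh) G ≤
      κE * bsum (fun b => (((sh b).fat : ℕ) : ℝ) + 1) G + μE * partnerAges (PEv.step ∘ sh) G)
    (z : γ) :
    ((S zone ρ c₀ (PEv.step ∘ sh) G z).card : ℝ) ≤
      Real.exp ((2 + ((WB + WM) / (1 - θ) + 2 * γ') + (2 * (a + d' * c₁) + d' * C₁ * ((WB + WM) / (1 - θ))) + κE) *
          bsum (fun b => (((sh b).fat : ℕ) : ℝ) + 1) G) *
        (Λ * Real.exp μE) ^ partnerAges (PEv.step ∘ sh) G :=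
  card_S_le_exp_pow (PEv.step ∘ sh) (Msup zone ρ c₀ (PEv.step ∘ sh)) (extsup zone ρ c₀ (PEv.step ∘ sh) δ) NZ Mρ
    zone ρ c₀ near (fun t Z _ hp => card_zone_le_Msup zone ρ c₀ (PEv.step ∘ sh) t Z hp)
    (fun t Z p u hp hu => near_extsup zone ρ c₀ (PEv.step ∘ sh) δ near hmono hnearW t Z p u hp hu) hNZ hΛ hMρ0 hNZle
    (fun b => (sh b).fat) G (MS_sup_le_bsum zone ρ c₀ sh hθ0 hθ1 hB hM hγ hD hC hlawM)
    (MρP_sup_le_exp_bsum zone ρ c₀ δ sh Mρ ha hd hMρ0 hMρ hC₁ hc₁ hθ0 hθ1 hB hM hD hC hlawE) hENT z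

end Generic

/-! ## §2 The END on the torus at levels -/

section Torus

variable {ε R : Type*} [LinearOrder R] {d n L K D : ℕ} [DecidableEq ε] (sh : ε → PEv) (lv : ℕ → ℕ)
  (zone : ℕ → Gen ε → (Addr D → TCell d (n * L ^ K)) → Finset (Fin d → ℕ))
  (ρ : (Addr D → TCell d (n * L ^ K)) → R) (c₀ : TCell d (n * L ^ K))

omit [LinearOrder R] [DecidableEq ε] in
/-- the per-placement cardinality law follows from the four reading facts asked of nonempty zones (an empty zone
costs `0 ≤ zmass + γ′`) [folklore] -/
theorem hlawM_of_facts [LinearOrder R] {ρℓ : ℕ} {θ WB WM γ' : ℝ} (hθ0 : 0 ≤ θ) (hB : 0 ≤ WB) (hM : 0 ≤ WM)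
    (hγ : 0 ≤ γ') {G : Gen ε}
    (hfacts : ∀ X ∈ joins (PEv.step ∘ sh) G, ∀ P ∈ tparts (PEv.step ∘ sh) X,
      ∀ p ∈ Sany zone ρ c₀ (PEv.step ∘ sh) P, (zone (ftime (PEv.step ∘ sh) X) P p).Nonempty →
        InRange (n * L ^ (K - lv (ftime (PEv.step ∘ sh) X))) (zone (ftime (PEv.step ∘ sh) X) P p) ∧
        Linked (n * L ^ (K - lv (ftime (PEv.step ∘ sh) X))) ρℓ (zone (ftime (PEv.step ∘ sh) X) P p) ∧
        blk L (lv (ftime (PEv.step ∘ sh) X)) (evalA c₀ p (rootAddr P)) ∈ zone (ftime (PEv.step ∘ sh) X) P p ∧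
        ((zone (ftime (PEv.step ∘ sh) X) P p).card : ℝ) ≤ zmass sh θ WB WM (ftime (PEv.step ∘ sh) X) P + γ') :
    ∀ X ∈ joins (PEv.step ∘ sh) G, ∀ P ∈ tparts (PEv.step ∘ sh) X,
      ∀ p ∈ Sany zone ρ c₀ (PEv.step ∘ sh) P,
        ((zone (ftime (PEv.step ∘ sh) X) P p).card : ℝ) ≤ zmass sh θ WB WM (ftime (PEv.step ∘ sh) X) P + γ' := by
  intro X hX P hP p hp
  rcases (zone (ftime (PEv.step ∘ sh) X) P p).eq_empty_or_nonempty with h0 | hne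
  · rw [h0, card_empty, Nat.cast_zero]
    exact add_nonneg (zmass_nonneg (sh := sh) hθ0 hB hM _ P) hγ
  · exact (hfacts X hX P hP p hp hne).2.2.2

/-- **ROW S6g′, THE END ON THE TORUS AT LEVELS.**  Cells `TCell d (n·L^K)`, zone blocks `Fin d → ℕ` on the level-`lv t`
torus of side `n·L^{K − lv t}`, nearness `nearD n L K lv` (leaf-07 gen 2's `touchD` at a real radius), witness radius
= cyclic sup-distance to the root cell's block, `NZ := NZD d L lv`, `Mρ := MρT d`, `Λ := L^d`.  Displayed: the guarded
reading fact `hzoneW`, the four per-placement reading facts at the joins `hfacts` (nonempty zones: in range,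
`ρℓ`-linked, root block inside, cardinality law), `Dated`∕`Chrono`, `hENT`, `LevelFn K lv`, `1 ≤ L`, signs:
`#S G z ≤ exp((2 + κM + κρ + κE)·F)·(L^d·e^{μE})^{partnerAges}`, `κM = (WB+WM)∕(1−θ) + 2γ′`,
`κρ = 2(0 + 2d·ρℓγ′) + 2d·ρℓ·(WB+WM)∕(1−θ)`. [folklore] -/
theorem card_S_le_exp_pow_torus (hL : 1 ≤ L) (hlv : LevelFn K lv)
    (hzoneW : ∀ (t : ℕ) (Z : Gen ε) (p : Addr D → TCell d (n * L ^ K)) (u : Fin d → ℕ),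
      p ∈ Sany zone ρ c₀ (PEv.step ∘ sh) Z → u ∈ zone t Z p →
        lv t ≤ K ∧ IsScale L (lv Z.rootStep) (evalA c₀ p (rootAddr Z)) ∧ ∀ i, u i < n * L ^ (K - lv t))
    {ρℓ : ℕ} {θ WB WM γ' : ℝ} (hθ0 : 0 ≤ θ) (hθ1 : θ < 1) (hB : 0 ≤ WB) (hM : 0 ≤ WM) (hγ : 0 ≤ γ')
    {G : Gen ε} {T : ℕ} (hD : Dated (PEv.step ∘ sh) true T G) (hC : Chrono (PEv.step ∘ sh) G)
    (hfacts : ∀ X ∈ joins (PEv.step ∘ sh) G, ∀ P ∈ tparts (PEv.step ∘ sh) X,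
      ∀ p ∈ Sany zone ρ c₀ (PEv.step ∘ sh) P, (zone (ftime (PEv.step ∘ sh) X) P p).Nonempty →
        InRange (n * L ^ (K - lv (ftime (PEv.step ∘ sh) X))) (zone (ftime (PEv.step ∘ sh) X) P p) ∧
        Linked (n * L ^ (K - lv (ftime (PEv.step ∘ sh) X))) ρℓ (zone (ftime (PEv.step ∘ sh) X) P p) ∧
        blk L (lv (ftime (PEv.step ∘ sh) X)) (evalA c₀ p (rootAddr P)) ∈ zone (ftime (PEv.step ∘ sh) X) P p ∧
        ((zone (ftime (PEv.step ∘ sh) X) P p).card : ℝ) ≤ zmass sh θ WB WM (ftime (PEv.step ∘ sh) X) P + γ')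
    {κE μE : ℝ}
    (hENT : ENT (PEv.step ∘ sh) G ≤
      κE * bsum (fun b => (((sh b).fat : ℕ) : ℝ) + 1) G + μE * partnerAges (PEv.step ∘ sh) G)
    (z : TCell d (n * L ^ K)) :
    ((S zone ρ c₀ (PEv.step ∘ sh) G z).card : ℝ) ≤
      Real.exp ((2 + ((WB + WM) / (1 - θ) + 2 * γ') +
            (2 * (0 + 2 * (d : ℝ) * ((ρℓ : ℝ) * γ')) + 2 * (d : ℝ) * ρℓ * ((WB + WM) / (1 - θ))) + κE) *
          bsum (fun b => (((sh b).fat : ℕ) : ℝ) + 1) G) *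
        ((L : ℝ) ^ d * Real.exp μE) ^ partnerAges (PEv.step ∘ sh) G :=
  card_S_le_exp_pow_sup sh zone ρ c₀
    (radT (fun t => n * L ^ (K - lv t)) (fun t y => blk L (lv t) y)) (nearD n L K lv) (nearD_mono n L K lv)
    (fun t Z p u hp hu => by
      obtain ⟨htK, hsc, hrange⟩ := hzoneW t Z p u hp hu
      exact nearD_of_scale htK hsc hrange)
    (NZD d L lv) (fun u t s r => card_nearD_le n hL K lv u t s r) (by positivity) (MρT d) (MρT_nonneg d)
    (fun r t s => NZD_le hlv hL d r t s) le_rfl (by positivity) (fun r hr => MρT_le_exp d hr)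
    hθ0 hθ1 hB hM hγ (Nat.cast_nonneg ρℓ) (mul_nonneg (Nat.cast_nonneg ρℓ) hγ) hD hC
    (hlawM_of_facts sh lv zone ρ c₀ hθ0 hB hM hγ hfacts)
    (hlawE_of_linked zone ρ c₀ (fun t => n * L ^ (K - lv t)) (fun t y => blk L (lv t) y) sh hfacts) hENT z

end Torus

/-! ## §3 (v2) The END with an ENTROPY SLACK `Ξ` — the slot for the renewals' booked cost

The entropy END on the canonical flat member (leaf-10 gen 3's `ENT_leR_gen`, leaf-05 gen 3's
`HistoryRenewalsCostCanon.ENT_le_gen_canon`) reads `ENT ≤ 2·Σ_births(1+fat) + 4·partnerAges + 8·mrg + (8∕φ)·T` with the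
BOOKED COST `T` of the tagged member — a third class key, not of the form `κE·F + μE·partnerAges`.  The END is therefore
re-assembled from the rank-free budget (`card_S_le_budgetE`) with an ARBITRARY additive slack `Ξ` in the entropy binder;
the slack leaves the bound as a factor `exp Ξ`. -/

section Slack

variable {ε γ β R : Type*} [DecidableEq β] [LinearOrder R] [Fintype γ] {D : ℕ}
  (st : ε → ℕ) (M : ℕ → Gen ε → ℕ) (ext : ℕ → Gen ε → ℝ) (NZ : ℝ → ℕ → ℕ → ℕ) (Mρ : ℝ → ℝ)

/-- **THE END WITH AN ENTROPY SLACK** (leaf-05 gen 2's `card_S_le_exp_pow` re-assembled): under the same displayed laws and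
class-linear inputs, with `hENT : ENT ≤ κE·F + μE·partnerAges + Ξ`,
`#S G z ≤ exp((2 + κM + κρ + κE)·F + Ξ)·(Λ·e^{μE})^{partnerAges}`. [folklore] -/
theorem card_S_le_exp_pow_slack
    (zone : ℕ → Gen ε → (Addr D → γ) → Finset β) (ρ : (Addr D → γ) → R) (c₀ : γ)
    (near : β → ℕ → γ → ℕ → ℝ → Prop)
    (hcard : ∀ (t : ℕ) (Z : Gen ε) (p : Addr D → γ), p ∈ Sany zone ρ c₀ st Z → (zone t Z p).card ≤ M t Z)
    (hloc : ∀ (t : ℕ) (Z : Gen ε) (p : Addr D → γ) (u : β), p ∈ Sany zone ρ c₀ st Z → u ∈ zone t Z p →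
      near u t (evalA c₀ p (rootAddr Z)) Z.rootStep (ext t Z))
    (hNZ : ∀ (u : β) (t s : ℕ) (r : ℝ), (univ.filter fun y : γ => near u t y s r).card ≤ NZ r t s)
    {Λ : ℝ} (hΛ : 0 ≤ Λ) (hMρ0 : ∀ r, 0 ≤ Mρ r) (hNZle : ∀ (r : ℝ) (t s : ℕ), (NZ r t s : ℝ) ≤ Mρ r * Λ ^ (t + 1 - s))
    (fat : ε → ℕ) (G : Gen ε) {κM κρ κE μE Ξ : ℝ}
    (hMS : MS st M G ≤ κM * bsum (fun b => (fat b : ℝ) + 1) G)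
    (hMρP : MρP st ext Mρ G ≤ Real.exp (κρ * bsum (fun b => (fat b : ℝ) + 1) G))
    (hENT : ENT st G ≤ κE * bsum (fun b => (fat b : ℝ) + 1) G + μE * partnerAges st G + Ξ) (z : γ) :
    ((S zone ρ c₀ st G z).card : ℝ) ≤
      Real.exp ((2 + κM + κρ + κE) * bsum (fun b => (fat b : ℝ) + 1) G + Ξ) *
        (Λ * Real.exp μE) ^ partnerAges st G := by
  set F := bsum (fun b => (fat b : ℝ) + 1) G
  set pa := partnerAges st G
  have h0 := card_S_le_budgetE st M ext NZ zone ρ c₀ near hcard hloc hNZ G z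
  have hmrg := mrg_le_bsum st fat G
  have hNZP := NZP_le_pow st ext NZ Mρ hΛ hMρ0 hNZle G
  have hexp : Real.exp (2 * mrg st G + MS st M G + ENT st G) ≤ Real.exp ((2 + κM + κE) * F + μE * pa + Ξ) := by
    refine Real.exp_le_exp.2 ?_
    have : 2 * mrg st G ≤ 2 * F := by linarith
    nlinarith [this, hMS, hENT]
  calc ((S zone ρ c₀ st G z).card : ℝ) ≤ budgetE st M ext NZ G := h0
    _ = Real.exp (2 * mrg st G + MS st M G + ENT st G) * NZP st ext NZ G := rfl
    _ ≤ Real.exp ((2 + κM + κE) * F + μE * pa + Ξ) * (MρP st ext Mρ G * Λ ^ pa) :=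
        mul_le_mul hexp hNZP (NZP_nonneg st ext NZ G) (Real.exp_pos _).le
    _ ≤ Real.exp ((2 + κM + κE) * F + μE * pa + Ξ) * (Real.exp (κρ * F) * Λ ^ pa) :=
        mul_le_mul_of_nonneg_left (mul_le_mul_of_nonneg_right hMρP (pow_nonneg hΛ _)) (Real.exp_pos _).le
    _ = Real.exp ((2 + κM + κρ + κE) * F + Ξ) * (Λ * Real.exp μE) ^ pa := by
        rw [mul_pow, ← Real.exp_nat_mul, ← mul_assoc, ← Real.exp_add, mul_comm (Λ ^ pa), ← mul_assoc,
          ← Real.exp_add]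
        congr 2
        ring

end Slack

section SlackSup

variable {ε γ β R : Type*} [DecidableEq β] [LinearOrder R] [Fintype γ] {D : ℕ} [DecidableEq ε] (sh : ε → PEv)
  (zone : ℕ → Gen ε → (Addr D → γ) → Finset β) (ρ : (Addr D → γ) → R) (c₀ : γ)
  (δ : β → ℕ → γ → ℕ → ℝ) (near : β → ℕ → γ → ℕ → ℝ → Prop)

/-- **§1's END WITH THE SLACK**: `card_S_le_exp_pow_sup` with `hENT : ENT ≤ κE·F + μE·partnerAges + Ξ`. [folklore] -/
theorem card_S_le_exp_pow_sup_slack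
    (hmono : ∀ u t y s (r r' : ℝ), near u t y s r → r ≤ r' → near u t y s r')
    (hnearW : ∀ (t : ℕ) (Z : Gen ε) (p : Addr D → γ) (u : β), p ∈ Sany zone ρ c₀ (PEv.step ∘ sh) Z →
      u ∈ zone t Z p → near u t (evalA c₀ p (rootAddr Z)) Z.rootStep (δ u t (evalA c₀ p (rootAddr Z)) Z.rootStep))
    (NZ : ℝ → ℕ → ℕ → ℕ)
    (hNZ : ∀ (u : β) (t s : ℕ) (r : ℝ), (univ.filter fun y : γ => near u t y s r).card ≤ NZ r t s)
    {Λ : ℝ} (hΛ : 0 ≤ Λ) (Mρ : ℝ → ℝ) (hMρ0 : ∀ r, 0 ≤ Mρ r)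
    (hNZle : ∀ (r : ℝ) (t s : ℕ), (NZ r t s : ℝ) ≤ Mρ r * Λ ^ (t + 1 - s))
    {a d' : ℝ} (ha : 0 ≤ a) (hd : 0 ≤ d') (hMρ : ∀ r, 0 ≤ r → Mρ r ≤ Real.exp (a + d' * r))
    {θ WB WM γ' C₁ c₁ : ℝ} (hθ0 : 0 ≤ θ) (hθ1 : θ < 1) (hB : 0 ≤ WB) (hM : 0 ≤ WM) (hγ : 0 ≤ γ')
    (hC₁ : 0 ≤ C₁) (hc₁ : 0 ≤ c₁)
    {G : Gen ε} {T : ℕ} (hD : Dated (PEv.step ∘ sh) true T G) (hC : Chrono (PEv.step ∘ sh) G)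
    (hlawM : ∀ X ∈ joins (PEv.step ∘ sh) G, ∀ P ∈ tparts (PEv.step ∘ sh) X,
      ∀ p ∈ Sany zone ρ c₀ (PEv.step ∘ sh) P,
        ((zone (ftime (PEv.step ∘ sh) X) P p).card : ℝ) ≤ zmass sh θ WB WM (ftime (PEv.step ∘ sh) X) P + γ')
    (hlawE : ∀ X ∈ joins (PEv.step ∘ sh) G, ∀ P ∈ tparts (PEv.step ∘ sh) X,
      ∀ p ∈ Sany zone ρ c₀ (PEv.step ∘ sh) P, ∀ u ∈ zone (ftime (PEv.step ∘ sh) X) P p,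
        δ u (ftime (PEv.step ∘ sh) X) (evalA c₀ p (rootAddr P)) P.rootStep ≤
          C₁ * zmass sh θ WB WM (ftime (PEv.step ∘ sh) X) P + c₁)
    {κE μE Ξ : ℝ}
    (hENT : ENT (PEv.step ∘ sh) G ≤
      κE * bsum (fun b => (((sh b).fat : ℕ) : ℝ) + 1) G + μE * partnerAges (PEv.step ∘ sh) G + Ξ)
    (z : γ) :
    ((S zone ρ c₀ (PEv.step ∘ sh) G z).card : ℝ) ≤
      Real.exp ((2 + ((WB + WM) / (1 - θ) + 2 * γ') + (2 * (a + d' * c₁) + d' * C₁ * ((WB + WM) / (1 - θ))) + κE) *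
          bsum (fun b => (((sh b).fat : ℕ) : ℝ) + 1) G + Ξ) *
        (Λ * Real.exp μE) ^ partnerAges (PEv.step ∘ sh) G :=
  card_S_le_exp_pow_slack (PEv.step ∘ sh) (Msup zone ρ c₀ (PEv.step ∘ sh)) (extsup zone ρ c₀ (PEv.step ∘ sh) δ) NZ Mρ
    zone ρ c₀ near (fun t Z _ hp => card_zone_le_Msup zone ρ c₀ (PEv.step ∘ sh) t Z hp)
    (fun t Z p u hp hu => near_extsup zone ρ c₀ (PEv.step ∘ sh) δ near hmono hnearW t Z p u hp hu) hNZ hΛ hMρ0 hNZle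
    (fun b => (sh b).fat) G (MS_sup_le_bsum zone ρ c₀ sh hθ0 hθ1 hB hM hγ hD hC hlawM)
    (MρP_sup_le_exp_bsum zone ρ c₀ δ sh Mρ ha hd hMρ0 hMρ hC₁ hc₁ hθ0 hθ1 hB hM hD hC hlawE) hENT z

end SlackSup

section SlackTorus

variable {ε R : Type*} [LinearOrder R] {d n L K D : ℕ} [DecidableEq ε] (sh : ε → PEv) (lv : ℕ → ℕ)
  (zone : ℕ → Gen ε → (Addr D → TCell d (n * L ^ K)) → Finset (Fin d → ℕ))
  (ρ : (Addr D → TCell d (n * L ^ K)) → R) (c₀ : TCell d (n * L ^ K))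

/-- **§2's TORUS END WITH THE SLACK**: `card_S_le_exp_pow_torus` with `hENT : ENT ≤ κE·F + μE·partnerAges + Ξ`.
[folklore] -/
theorem card_S_le_exp_pow_torus_slack (hL : 1 ≤ L) (hlv : LevelFn K lv)
    (hzoneW : ∀ (t : ℕ) (Z : Gen ε) (p : Addr D → TCell d (n * L ^ K)) (u : Fin d → ℕ),
      p ∈ Sany zone ρ c₀ (PEv.step ∘ sh) Z → u ∈ zone t Z p →
        lv t ≤ K ∧ IsScale L (lv Z.rootStep) (evalA c₀ p (rootAddr Z)) ∧ ∀ i, u i < n * L ^ (K - lv t))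
    {ρℓ : ℕ} {θ WB WM γ' : ℝ} (hθ0 : 0 ≤ θ) (hθ1 : θ < 1) (hB : 0 ≤ WB) (hM : 0 ≤ WM) (hγ : 0 ≤ γ')
    {G : Gen ε} {T : ℕ} (hD : Dated (PEv.step ∘ sh) true T G) (hC : Chrono (PEv.step ∘ sh) G)
    (hfacts : ∀ X ∈ joins (PEv.step ∘ sh) G, ∀ P ∈ tparts (PEv.step ∘ sh) X,
      ∀ p ∈ Sany zone ρ c₀ (PEv.step ∘ sh) P, (zone (ftime (PEv.step ∘ sh) X) P p).Nonempty →
        InRange (n * L ^ (K - lv (ftime (PEv.step ∘ sh) X))) (zone (ftime (PEv.step ∘ sh) X) P p) ∧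
        Linked (n * L ^ (K - lv (ftime (PEv.step ∘ sh) X))) ρℓ (zone (ftime (PEv.step ∘ sh) X) P p) ∧
        blk L (lv (ftime (PEv.step ∘ sh) X)) (evalA c₀ p (rootAddr P)) ∈ zone (ftime (PEv.step ∘ sh) X) P p ∧
        ((zone (ftime (PEv.step ∘ sh) X) P p).card : ℝ) ≤ zmass sh θ WB WM (ftime (PEv.step ∘ sh) X) P + γ')
    {κE μE Ξ : ℝ}
    (hENT : ENT (PEv.step ∘ sh) G ≤
      κE * bsum (fun b => (((sh b).fat : ℕ) : ℝ) + 1) G + μE * partnerAges (PEv.step ∘ sh) G + Ξ)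
    (z : TCell d (n * L ^ K)) :
    ((S zone ρ c₀ (PEv.step ∘ sh) G z).card : ℝ) ≤
      Real.exp ((2 + ((WB + WM) / (1 - θ) + 2 * γ') +
            (2 * (0 + 2 * (d : ℝ) * ((ρℓ : ℝ) * γ')) + 2 * (d : ℝ) * ρℓ * ((WB + WM) / (1 - θ))) + κE) *
          bsum (fun b => (((sh b).fat : ℕ) : ℝ) + 1) G + Ξ) *
        ((L : ℝ) ^ d * Real.exp μE) ^ partnerAges (PEv.step ∘ sh) G :=
  card_S_le_exp_pow_sup_slack sh zone ρ c₀
    (radT (fun t => n * L ^ (K - lv t)) (fun t y => blk L (lv t) y)) (nearD n L K lv) (nearD_mono n L K lv)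
    (fun t Z p u hp hu => by
      obtain ⟨htK, hsc, hrange⟩ := hzoneW t Z p u hp hu
      exact nearD_of_scale htK hsc hrange)
    (NZD d L lv) (fun u t s r => card_nearD_le n hL K lv u t s r) (by positivity) (MρT d) (MρT_nonneg d)
    (fun r t s => NZD_le hlv hL d r t s) le_rfl (by positivity) (fun r hr => MρT_le_exp d hr)
    hθ0 hθ1 hB hM hγ (Nat.cast_nonneg ρℓ) (mul_nonneg (Nat.cast_nonneg ρℓ) hγ) hD hC
    (hlawM_of_facts sh lv zone ρ c₀ hθ0 hB hM hγ hfacts)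
    (hlawE_of_linked zone ρ c₀ (fun t => n * L ^ (K - lv t)) (fun t y => blk L (lv t) y) sh hfacts) hENT z

omit [LinearOrder R] [DecidableEq ε] in
/-- the entropy END's right-hand side in leaf-10 gen 3 ∕ leaf-05 gen 3's letters, `2·Σ(1+fat) + 4·pa + 8·mrg + Ξ`, is of
the slack form with `κE := 10`, `μE := 4`, `Ξ := Ξ − 8` (`mrg ≤ F − 1`, `HistoryJoinsEnd.mrg_le_bsum`) [folklore] -/
theorem hENT_of_renewForm {G : Gen ε} {Ξ : ℝ}
    (hENT8 : ENT (PEv.step ∘ sh) G ≤ 2 * bsum (fun b => (1 : ℝ) + (((sh b).fat : ℕ) : ℝ)) G +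
      4 * (partnerAges (PEv.step ∘ sh) G : ℝ) + 8 * mrg (PEv.step ∘ sh) G + Ξ) :
    ENT (PEv.step ∘ sh) G ≤
      10 * bsum (fun b => (((sh b).fat : ℕ) : ℝ) + 1) G + 4 * partnerAges (PEv.step ∘ sh) G + (Ξ - 8) := by
  have hmrg := mrg_le_bsum (PEv.step ∘ sh) (fun b => (sh b).fat) G
  have heq : bsum (fun b => (1 : ℝ) + (((sh b).fat : ℕ) : ℝ)) G = bsum (fun b => (((sh b).fat : ℕ) : ℝ) + 1) G := by
    congr 1; funext b; ring
  rw [heq] at hENT8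
  have hF0 : 0 ≤ bsum (fun b => (((sh b).fat : ℕ) : ℝ) + 1) G := bsum_nonneg (fun b => by positivity) G
  linarith

/-- **THE TORUS END IN THE ENTROPY ROAD's LETTERS**: with `hENT8 : ENT ≤ 2·Σ_births(1+fat) + 4·partnerAges + 8·mrg + Ξ`
(`Ξ := (8∕φ)·totalCostT …` from `HistoryRenewalsCostCanon.ENT_le_gen_canon`, or any other slack),
`#S G z ≤ exp((12 + κM + κρ)·F + (Ξ − 8))·(L^d·e⁴)^{partnerAges}`, `κM = (WB+WM)∕(1−θ) + 2γ′`,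
`κρ = 8d·ρℓ·γ′ + 2d·ρℓ·(WB+WM)∕(1−θ)` (written as in `card_S_le_exp_pow_torus`). [folklore] -/
theorem card_S_le_exp_pow_torus_renew (hL : 1 ≤ L) (hlv : LevelFn K lv)
    (hzoneW : ∀ (t : ℕ) (Z : Gen ε) (p : Addr D → TCell d (n * L ^ K)) (u : Fin d → ℕ),
      p ∈ Sany zone ρ c₀ (PEv.step ∘ sh) Z → u ∈ zone t Z p →
        lv t ≤ K ∧ IsScale L (lv Z.rootStep) (evalA c₀ p (rootAddr Z)) ∧ ∀ i, u i < n * L ^ (K - lv t))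
    {ρℓ : ℕ} {θ WB WM γ' : ℝ} (hθ0 : 0 ≤ θ) (hθ1 : θ < 1) (hB : 0 ≤ WB) (hM : 0 ≤ WM) (hγ : 0 ≤ γ')
    {G : Gen ε} {T : ℕ} (hD : Dated (PEv.step ∘ sh) true T G) (hC : Chrono (PEv.step ∘ sh) G)
    (hfacts : ∀ X ∈ joins (PEv.step ∘ sh) G, ∀ P ∈ tparts (PEv.step ∘ sh) X,
      ∀ p ∈ Sany zone ρ c₀ (PEv.step ∘ sh) P, (zone (ftime (PEv.step ∘ sh) X) P p).Nonempty →
        InRange (n * L ^ (K - lv (ftime (PEv.step ∘ sh) X))) (zone (ftime (PEv.step ∘ sh) X) P p) ∧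
        Linked (n * L ^ (K - lv (ftime (PEv.step ∘ sh) X))) ρℓ (zone (ftime (PEv.step ∘ sh) X) P p) ∧
        blk L (lv (ftime (PEv.step ∘ sh) X)) (evalA c₀ p (rootAddr P)) ∈ zone (ftime (PEv.step ∘ sh) X) P p ∧
        ((zone (ftime (PEv.step ∘ sh) X) P p).card : ℝ) ≤ zmass sh θ WB WM (ftime (PEv.step ∘ sh) X) P + γ')
    {Ξ : ℝ}
    (hENT8 : ENT (PEv.step ∘ sh) G ≤ 2 * bsum (fun b => (1 : ℝ) + (((sh b).fat : ℕ) : ℝ)) G +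
      4 * (partnerAges (PEv.step ∘ sh) G : ℝ) + 8 * mrg (PEv.step ∘ sh) G + Ξ)
    (z : TCell d (n * L ^ K)) :
    ((S zone ρ c₀ (PEv.step ∘ sh) G z).card : ℝ) ≤
      Real.exp ((2 + ((WB + WM) / (1 - θ) + 2 * γ') +
            (2 * (0 + 2 * (d : ℝ) * ((ρℓ : ℝ) * γ')) + 2 * (d : ℝ) * ρℓ * ((WB + WM) / (1 - θ))) + 10) *
          bsum (fun b => (((sh b).fat : ℕ) : ℝ) + 1) G + (Ξ - 8)) *
        ((L : ℝ) ^ d * Real.exp 4) ^ partnerAges (PEv.step ∘ sh) G :=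
  card_S_le_exp_pow_torus_slack sh lv zone ρ c₀ hL hlv hzoneW hθ0 hθ1 hB hM hγ hD hC hfacts
    (hENT_of_renewForm sh hENT8) z

end SlackTorus

end

end Summit.QuantumFields.BalabanUV.T4Continuum.HistoryJoinsSupEnd
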